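import Summits.ABC.ABC.Theorems.IUTThetaPilotThetaPartIIULineCapstone
import Summits.ABC.IUTFork.LDHGenuineHullRegimeSlack
import Summits.ABC.IUTFork.LDHGenuineStepVPoint
import HarnessLib

/-!
# Crux `ThetaPartII` (stmt-ABC-19678, route `IUTThetaPilot`), (U) line: the regime stub `stub_hullRegime` CUT DOWN to
# the high-height, `d_mod ≥ 2`, non-slot-constant data — and `ABC` from `stub_cor312` + that cut-down binder alone

Mochizuki, *Inter-universal Teichmüller theory IV*, RIMS manuscript (Apr. 2020; = PRIMS **57** (2021)), Thm. 1.10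
(pp. 22–31) with its proof Steps (ii)–(viii) (pp. 24–31), Cor. 2.2 (ii) (pp. 41–48), Cor. 2.3 (pp. 49–55); [IUTchIII]
Cor. 3.12 (kurims p. 174: "the holomorphic hull of the union of the possible images of the Θ-pilot object").

Record-only, proof-only file (D-0012) of the abc-iut cell (campaign-S seat abc-iut-S3; abc-iut-plan R-g8-7c/R-g8-8: the
above-threshold refinement of the (U)-line capstone). TAKES NO SIDE on [IUTchIII] Cor. 3.12 or on the reading (U)/(P) of
`−|log(Θ)|` (ref-b B14 §1: (U) is the number of the printed STATEMENT). Everything here is CONDITIONAL on the named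
hypotheses; nothing is asserted about any point.

Context (2026-08-26): on the (U) line of the registered RESHAPE-2 skeleton of the crux (abc-iut-c312-8, sha16
3f4b202b4c999d58) the open stubs are `stub_cor312` (the disputed Corollary at the genuine Θ-volume data of the admissible
Legendre points) and `stub_hullRegime` (plan VERDICT RISK ¶7: the (U)-hull estimate with print's constant `B_III(P,l)` OFF
the slot-constant regime); abc-iut-c312-8's capstone `ThetaPartII.ABC_of_cor312_of_hullRegime`
(`IUTThetaPilotThetaPartIIULineCapstone.lean`, p428563) derives `ABC` from exactly these two. THIS FILE derives the
registered `stub_hullRegime` body from a STRICTLY WEAKER named hypothesis — the same estimate demanded ONLY where nothing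
in the tree supplies it — and composes:

* `ThetaPartII.hullRegime_of_hullRegimeAbove` (at one admissible `(P, l)`) / `ThetaPartII.stubHullRegime_of_above` (the
  registered bytes): the regime body from the estimate for the NON-slot-constant data assumed ONLY WHEN `2 ≤ d_mod` AND
  `log(q^{∤{2,l}}(λ))` lies ABOVE abc-iut-c312-d1's threshold
  `40·log(d*·l)·(π(d*·l) − (2·d_mod·(log-diff + log 𝔣^{∤{2,l}}) + log(30·l))/log 2)` (`≈ 2.2·10⁷·d_mod·l`): below the
  threshold the slot residue fits into the slack of the Step (viii) term (abc-iut-c312-d1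
  `PointDict.hullEstimateOf_BIII_of_logQAvoid_le`, `LDHGenuineHullRegimeSlack.lean`, over abc-iut-S8's slot residue and
  abc-iut-S3's `deltaK_le_BIII_of_le21` / `deltaExplicit_le_BIII_pinned`); at `d_mod = 1` the antecedent is void (every datum
  is slot-constant, abc-iut-c312-d1 `PointStepV.slotConstant_of_dmod_eq_one`);
* `ThetaPartII.hullVolumeAtDatum_BIII_of_hullRegimeAbove` — the volume child (ii′-U) `Cor22.HullVolumeAtDatum P l (B_III P l)`
  at an admissible `(P, l)` from the cut-down hypothesis at `(P, l)` (slot-constant data: abc-iut-S3's pinned junction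
  `PointDict.hullEstimateOf_BIII_pinned`, [IUTchIV] Thm. 1.10 Steps (ii)–(v) with every classical input discharged, fed with
  abc-iut-S1's (R4) e-term `ThetaVolumeDatumAt.R4_towerFact`, Step (iii) (R4) p. 26);
* **`ThetaPartII.ThetaPartII_of_cor312_of_hullRegimeAbove`, `ThetaPartII.ABC_of_cor312_of_hullRegimeAbove`** — the crux,
  resp. `ABC`, from `stub_cor312` verbatim and the cut-down binder `habove` ALONE, by abc-iut-c312-8's capstone.

So, in reading (U), the kernel distance between "[IUTchIII] Cor. 3.12 as stated, at the Θ-data of the `λ`-line" and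
`ABC` is exactly ONE named inequality of Szpiro type — `B_III` absorbs the (Ind1) slot residue at the genuine data of points
of degree `d_mod ≥ 2` whose `log(q^{∤{2,l}})` exceeds the threshold — claimed here in NEITHER direction (plan VERDICT RISK
¶7; abc-iut-S8 `slotResidue_le_of_hullEstimateOf` shows the display forces it back). For the C-branch certificate
`abc_of_S_v2` this is a strictly-weaker named replacement of its binder `hvol` (spec §2).
[cite: Mochizuki2012, IUTchIV Thm. 1.10 proof Steps (ii)–(viii) p. 24–31] [claim: Mochizuki2012, status: disputed] for
every IUT quotation; no side taken.
-/

noncomputable section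

set_option linter.dupNamespace false

namespace Summit.ABC.ABC.Theorems.ThetaPartII

open Literature.NumberTheory.DiophantineGeometry.GenEll Literature.IUT.LogVolume Literature.IUT.HodgeTheaters
open Summit.ABC.IUTFork NumberField IsDedekindDomain Literature.NumberTheory.NumberFields

variable {P : NFPoint} {l : ℕ}

/-- **The registered regime body at ONE admissible `(P, l)` from the cut-down hypothesis at `(P, l)`**: for `λ ∈ U_P`
(minimally presented) and `l ≥ 5` prime with (P6) (whence `l ≥ 7`, abc-iut-c312-8 `seven_le_of_condP6`): if the (U)-hull
estimate with `B_III(P,l)` holds for the NON-slot-constant genuine data at `(P, l)` PROVIDED `2 ≤ d_mod` AND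
`40·log(d*·l)·(π(d*·l) − (2·d_mod·(log-diff + log 𝔣^{∤{2,l}}) + log(30·l))/log 2) < log(q^{∤{2,l}}(λ))`, then it holds for
ALL non-slot-constant genuine data at `(P, l)` — below the threshold by abc-iut-c312-d1's
`PointDict.hullEstimateOf_BIII_of_logQAvoid_le` (the slot residue fits into the slack of [IUTchIV] Thm. 1.10 Step (viii)'s
prime-counting term), and at `d_mod = 1` vacuously (`PointStepV.slotConstant_of_dmod_eq_one`). CONDITIONAL on `habove`; no
side taken. [cite: Mochizuki2012, IUTchIV Thm. 1.10 proof Steps (v), (viii) p. 27–31] [claim: Mochizuki2012, status: disputed] -/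
theorem hullRegime_of_hullRegimeAbove (hP : P ∈ UP) (hl : l.Prime) (h5 : 5 ≤ l) (h6 : Cor22.CondP6 P l)
    (habove : 2 ≤ Cor22.dmod P →
      40 * Real.log (((2 ^ 12 * 3 ^ 3 * 5 * Cor22.dmod P : ℕ) : ℝ) * l)
        * ((Nat.primeCounting (2 ^ 12 * 3 ^ 3 * 5 * Cor22.dmod P * l) : ℝ)
          - (2 * (Cor22.dmod P : ℝ) * (P.logDiff + Cor22.logCondAvoid P {2, l}) + Real.log (2 * 3 * 5 * (l : ℝ)))
            / Real.log 2) < Cor22.logQAvoid P {2, l} →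
      ∀ T : Cor22.ThetaVolumeDatumAt P l,
        (letI := T.instFieldF; letI := T.instNumberFieldF; letI := T.instAlgebraF; letI := T.instFieldK
         letI := T.instNumberFieldK; letI := T.instAlgebraK; letI := T.instFieldFbar; letI := T.instAlgebraFbar
         letI := T.instAlgebraKFbar; letI := T.instIsElliptic
         ¬ (∀ p ∈ T.I.supportPrimes, ∀ v w : placesOver (fieldOfModuli T.E) p,
            (Summit.ABC.IUTFork.DHData.ofInput T.I).logQloc p v = (Summit.ABC.IUTFork.DHData.ofInput T.I).logQloc p w)) →
        T.HullEstimateOf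
          (((l : ℝ) + 1) / 4 *
            ((1 + 12 * (Cor22.dmod P : ℝ) / l) * (P.logDiff + Cor22.logCondAvoid P {2, l})
              + 2 * Real.log l + 52
              + 20 / 3 * Real.log (((2 ^ 12 * 3 ^ 3 * 5 * Cor22.dmod P : ℕ) : ℝ) * (l : ℝ))
                * (Nat.primeCounting (2 ^ 12 * 3 ^ 3 * 5 * Cor22.dmod P * l) : ℝ)))) :
      ∀ T : Cor22.ThetaVolumeDatumAt P l,
        (letI := T.instFieldF; letI := T.instNumberFieldF; letI := T.instAlgebraF; letI := T.instFieldK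
         letI := T.instNumberFieldK; letI := T.instAlgebraK; letI := T.instFieldFbar; letI := T.instAlgebraFbar
         letI := T.instAlgebraKFbar; letI := T.instIsElliptic
         ¬ (∀ p ∈ T.I.supportPrimes, ∀ v w : placesOver (fieldOfModuli T.E) p,
            (Summit.ABC.IUTFork.DHData.ofInput T.I).logQloc p v = (Summit.ABC.IUTFork.DHData.ofInput T.I).logQloc p w)) →
        T.HullEstimateOf
          (((l : ℝ) + 1) / 4 *
            ((1 + 12 * (Cor22.dmod P : ℝ) / l) * (P.logDiff + Cor22.logCondAvoid P {2, l})
              + 2 * Real.log l + 52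
              + 20 / 3 * Real.log (((2 ^ 12 * 3 ^ 3 * 5 * Cor22.dmod P : ℕ) : ℝ) * (l : ℝ))
                * (Nat.primeCounting (2 ^ 12 * 3 ^ 3 * 5 * Cor22.dmod P * l) : ℝ))) := by
  have h7 : 7 ≤ l := seven_le_of_condP6 hP hl h5 h6
  intro T
  letI := T.instFieldF; letI := T.instNumberFieldF; letI := T.instAlgebraF; letI := T.instFieldK
  letI := T.instNumberFieldK; letI := T.instAlgebraK; letI := T.instFieldFbar; letI := T.instAlgebraFbar
  letI := T.instAlgebraKFbar; letI := T.instIsElliptic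
  intro hnc
  -- below the threshold: abc-iut-c312-d1's slack theorem (no regime hypothesis at all)
  by_cases hlow : Cor22.logQAvoid P {2, l} ≤
      40 * Real.log (((2 ^ 12 * 3 ^ 3 * 5 * Cor22.dmod P : ℕ) : ℝ) * l)
        * ((Nat.primeCounting (2 ^ 12 * 3 ^ 3 * 5 * Cor22.dmod P * l) : ℝ)
          - (2 * (Cor22.dmod P : ℝ) * (P.logDiff + Cor22.logCondAvoid P {2, l}) + Real.log (2 * 3 * 5 * (l : ℝ)))
            / Real.log 2)
  · exact PointDict.hullEstimateOf_BIII_of_logQAvoid_le T hP h7 hlow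
  -- at `d_mod = 1` every datum is slot-constant: the antecedent is void
  by_cases hd : Cor22.dmod P = 1
  · exact absurd (PointStepV.slotConstant_of_dmod_eq_one T hd) hnc
  -- `d_mod ≥ 2`, above the threshold: the hypothesis
  have hd2 : 2 ≤ Cor22.dmod P := by have := Cor22.dmod_pos P; omega
  exact habove hd2 (lt_of_not_ge hlow) T hnc

/-- **The registered stub `stub_hullRegime` of the (U) line (its registered bytes) from the CUT-DOWN binder ALONE**:
`habove` asks for the (U)-hull estimate with `B_III` only at admissible `(P, l)` with `2 ≤ d_mod`, `log(q^{∤{2,l}}(λ))`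
above abc-iut-c312-d1's threshold, and non-slot-constant data — strictly weaker than `stub_hullRegime`, which it implies
(`hullRegime_of_hullRegimeAbove` pointwise). CONDITIONAL on `habove`; no side taken.
[cite: Mochizuki2012, IUTchIV Thm. 1.10 proof Steps (v), (viii) p. 27–31] [claim: Mochizuki2012, status: disputed] -/
theorem stubHullRegime_of_above
    (habove : ∀ P : NFPoint, P ∈ UP → ∀ l : ℕ, l.Prime → 5 ≤ l →
      Cor22.AdmitsCore P → Cor22.CondP2 P l → Cor22.CondP5 P l → Cor22.CondP6 P l →
      2 ≤ Cor22.dmod P →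
      40 * Real.log (((2 ^ 12 * 3 ^ 3 * 5 * Cor22.dmod P : ℕ) : ℝ) * l)
        * ((Nat.primeCounting (2 ^ 12 * 3 ^ 3 * 5 * Cor22.dmod P * l) : ℝ)
          - (2 * (Cor22.dmod P : ℝ) * (P.logDiff + Cor22.logCondAvoid P {2, l}) + Real.log (2 * 3 * 5 * (l : ℝ)))
            / Real.log 2) < Cor22.logQAvoid P {2, l} →
      ∀ T : Cor22.ThetaVolumeDatumAt P l,
        (letI := T.instFieldF; letI := T.instNumberFieldF; letI := T.instAlgebraF; letI := T.instFieldK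
         letI := T.instNumberFieldK; letI := T.instAlgebraK; letI := T.instFieldFbar; letI := T.instAlgebraFbar
         letI := T.instAlgebraKFbar; letI := T.instIsElliptic
         ¬ (∀ p ∈ T.I.supportPrimes, ∀ v w : placesOver (fieldOfModuli T.E) p,
            (Summit.ABC.IUTFork.DHData.ofInput T.I).logQloc p v = (Summit.ABC.IUTFork.DHData.ofInput T.I).logQloc p w)) →
        T.HullEstimateOf
          (((l : ℝ) + 1) / 4 *
            ((1 + 12 * (Cor22.dmod P : ℝ) / l) * (P.logDiff + Cor22.logCondAvoid P {2, l})
              + 2 * Real.log l + 52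
              + 20 / 3 * Real.log (((2 ^ 12 * 3 ^ 3 * 5 * Cor22.dmod P : ℕ) : ℝ) * (l : ℝ))
                * (Nat.primeCounting (2 ^ 12 * 3 ^ 3 * 5 * Cor22.dmod P * l) : ℝ)))) :
    ∀ P : NFPoint, P ∈ UP → ∀ l : ℕ, l.Prime → 5 ≤ l →
      Cor22.AdmitsCore P → Cor22.CondP2 P l → Cor22.CondP5 P l → Cor22.CondP6 P l →
      ∀ T : Cor22.ThetaVolumeDatumAt P l,
        (letI := T.instFieldF; letI := T.instNumberFieldF; letI := T.instAlgebraF; letI := T.instFieldK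
         letI := T.instNumberFieldK; letI := T.instAlgebraK; letI := T.instFieldFbar; letI := T.instAlgebraFbar
         letI := T.instAlgebraKFbar; letI := T.instIsElliptic
         ¬ (∀ p ∈ T.I.supportPrimes, ∀ v w : placesOver (fieldOfModuli T.E) p,
            (Summit.ABC.IUTFork.DHData.ofInput T.I).logQloc p v = (Summit.ABC.IUTFork.DHData.ofInput T.I).logQloc p w)) →
        T.HullEstimateOf
          (((l : ℝ) + 1) / 4 *
            ((1 + 12 * (Cor22.dmod P : ℝ) / l) * (P.logDiff + Cor22.logCondAvoid P {2, l})
              + 2 * Real.log l + 52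
              + 20 / 3 * Real.log (((2 ^ 12 * 3 ^ 3 * 5 * Cor22.dmod P : ℕ) : ℝ) * (l : ℝ))
                * (Nat.primeCounting (2 ^ 12 * 3 ^ 3 * 5 * Cor22.dmod P * l) : ℝ))) :=
  fun P hP l hl h5 hcore h2 hP5 h6 =>
    hullRegime_of_hullRegimeAbove hP hl h5 h6 (habove P hP l hl h5 hcore h2 hP5 h6)

/-- **(ii′-U) `Cor22.HullVolumeAtDatum P l (B_III P l)` at an admissible `(P, l)` from the cut-down hypothesis at
`(P, l)`**: non-slot-constant data by `hullRegime_of_hullRegimeAbove`; slot-constant data by abc-iut-S3's pinned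
tower-arithmetic junction `PointDict.hullEstimateOf_BIII_pinned` ([IUTchIV] Thm. 1.10 Steps (ii)–(v), every classical input
discharged) fed with abc-iut-S1's (R4) e-term `ThetaVolumeDatumAt.R4_towerFact` (Step (iii) (R4) p. 26). CONDITIONAL on
`habove`; no side taken. [cite: Mochizuki2012, IUTchIV Thm. 1.10 proof Steps (ii)–(viii) p. 24–31]
[claim: Mochizuki2012, status: disputed] -/
theorem hullVolumeAtDatum_BIII_of_hullRegimeAbove (hP : P ∈ UP) (hl : l.Prime) (h5 : 5 ≤ l) (h6 : Cor22.CondP6 P l)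
    (habove : 2 ≤ Cor22.dmod P →
      40 * Real.log (((2 ^ 12 * 3 ^ 3 * 5 * Cor22.dmod P : ℕ) : ℝ) * l)
        * ((Nat.primeCounting (2 ^ 12 * 3 ^ 3 * 5 * Cor22.dmod P * l) : ℝ)
          - (2 * (Cor22.dmod P : ℝ) * (P.logDiff + Cor22.logCondAvoid P {2, l}) + Real.log (2 * 3 * 5 * (l : ℝ)))
            / Real.log 2) < Cor22.logQAvoid P {2, l} →
      ∀ T : Cor22.ThetaVolumeDatumAt P l,
        (letI := T.instFieldF; letI := T.instNumberFieldF; letI := T.instAlgebraF; letI := T.instFieldK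
         letI := T.instNumberFieldK; letI := T.instAlgebraK; letI := T.instFieldFbar; letI := T.instAlgebraFbar
         letI := T.instAlgebraKFbar; letI := T.instIsElliptic
         ¬ (∀ p ∈ T.I.supportPrimes, ∀ v w : placesOver (fieldOfModuli T.E) p,
            (Summit.ABC.IUTFork.DHData.ofInput T.I).logQloc p v = (Summit.ABC.IUTFork.DHData.ofInput T.I).logQloc p w)) →
        T.HullEstimateOf
          (((l : ℝ) + 1) / 4 *
            ((1 + 12 * (Cor22.dmod P : ℝ) / l) * (P.logDiff + Cor22.logCondAvoid P {2, l})
              + 2 * Real.log l + 52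
              + 20 / 3 * Real.log (((2 ^ 12 * 3 ^ 3 * 5 * Cor22.dmod P : ℕ) : ℝ) * (l : ℝ))
                * (Nat.primeCounting (2 ^ 12 * 3 ^ 3 * 5 * Cor22.dmod P * l) : ℝ)))) :
    Cor22.HullVolumeAtDatum P l
      (((l : ℝ) + 1) / 4 *
        ((1 + 12 * (Cor22.dmod P : ℝ) / l) * (P.logDiff + Cor22.logCondAvoid P {2, l})
          + 2 * Real.log l + 52
          + 20 / 3 * Real.log (((2 ^ 12 * 3 ^ 3 * 5 * Cor22.dmod P : ℕ) : ℝ) * (l : ℝ))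
            * (Nat.primeCounting (2 ^ 12 * 3 ^ 3 * 5 * Cor22.dmod P * l) : ℝ))) := by
  have h7 : 7 ≤ l := seven_le_of_condP6 hP hl h5 h6
  have hreg := hullRegime_of_hullRegimeAbove hP hl h5 h6 habove
  intro T
  letI := T.instFieldF; letI := T.instNumberFieldF; letI := T.instAlgebraF; letI := T.instFieldK
  letI := T.instNumberFieldK; letI := T.instAlgebraK; letI := T.instFieldFbar; letI := T.instAlgebraFbar
  letI := T.instAlgebraKFbar; letI := T.instIsElliptic
  by_cases hc : ∀ p ∈ T.I.supportPrimes, ∀ v w : placesOver (fieldOfModuli T.E) p,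
      (Summit.ABC.IUTFork.DHData.ofInput T.I).logQloc p v = (Summit.ABC.IUTFork.DHData.ofInput T.I).logQloc p w
  · exact PointDict.hullEstimateOf_BIII_pinned T hP h7 (T.R4_towerFact hP) hc
  · exact hreg T hc

/-- **The crux `ThetaPartII` on the (U) line from `stub_cor312` and the CUT-DOWN regime binder ALONE**: [IUTchIII]
Cor. 3.12 in reading (U) at every genuine Θ-volume datum of every admissible `(P, l)` (`stub_cor312` verbatim — the disputed
claim, print's number) and the (U)-hull estimate with `B_III` ONLY for the non-slot-constant data at admissible `(P, l)` with
`2 ≤ d_mod` and `log(q^{∤{2,l}}(λ))` above abc-iut-c312-d1's threshold; via `stubHullRegime_of_above` and abc-iut-c312-8's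
capstone `ThetaPartII_of_cor312_of_hullRegime`. CONDITIONAL on exactly these two; the item stays OPEN; no side taken.
[cite: Mochizuki2012, IUTchIV Thm. 1.10, Cor. 2.2 (ii) pp.22–48] [claim: Mochizuki2012, status: disputed] -/
theorem ThetaPartII_of_cor312_of_hullRegimeAbove
    (h312 : ∀ P : NFPoint, P ∈ UP → ∀ l : ℕ, l.Prime → 5 ≤ l →
      Cor22.AdmitsCore P → Cor22.CondP2 P l → Cor22.CondP5 P l → Cor22.CondP6 P l → Cor22.Cor312AtDatum P l)
    (habove : ∀ P : NFPoint, P ∈ UP → ∀ l : ℕ, l.Prime → 5 ≤ l →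
      Cor22.AdmitsCore P → Cor22.CondP2 P l → Cor22.CondP5 P l → Cor22.CondP6 P l →
      2 ≤ Cor22.dmod P →
      40 * Real.log (((2 ^ 12 * 3 ^ 3 * 5 * Cor22.dmod P : ℕ) : ℝ) * l)
        * ((Nat.primeCounting (2 ^ 12 * 3 ^ 3 * 5 * Cor22.dmod P * l) : ℝ)
          - (2 * (Cor22.dmod P : ℝ) * (P.logDiff + Cor22.logCondAvoid P {2, l}) + Real.log (2 * 3 * 5 * (l : ℝ)))
            / Real.log 2) < Cor22.logQAvoid P {2, l} →
      ∀ T : Cor22.ThetaVolumeDatumAt P l,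
        (letI := T.instFieldF; letI := T.instNumberFieldF; letI := T.instAlgebraF; letI := T.instFieldK
         letI := T.instNumberFieldK; letI := T.instAlgebraK; letI := T.instFieldFbar; letI := T.instAlgebraFbar
         letI := T.instAlgebraKFbar; letI := T.instIsElliptic
         ¬ (∀ p ∈ T.I.supportPrimes, ∀ v w : placesOver (fieldOfModuli T.E) p,
            (Summit.ABC.IUTFork.DHData.ofInput T.I).logQloc p v = (Summit.ABC.IUTFork.DHData.ofInput T.I).logQloc p w)) →
        T.HullEstimateOf
          (((l : ℝ) + 1) / 4 *
            ((1 + 12 * (Cor22.dmod P : ℝ) / l) * (P.logDiff + Cor22.logCondAvoid P {2, l})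
              + 2 * Real.log l + 52
              + 20 / 3 * Real.log (((2 ^ 12 * 3 ^ 3 * 5 * Cor22.dmod P : ℕ) : ℝ) * (l : ℝ))
                * (Nat.primeCounting (2 ^ 12 * 3 ^ 3 * 5 * Cor22.dmod P * l) : ℝ)))) :
    Summit.ABC.ABC.Theses.IUTThetaPilot.ThetaPartII :=
  ThetaPartII_of_cor312_of_hullRegime h312 (stubHullRegime_of_above habove)

/-- **`ABC` on the (U) line from `stub_cor312` and the CUT-DOWN regime binder ALONE** — so that, in reading (U), the
kernel distance between "[IUTchIII] Cor. 3.12 as stated, at the Θ-data of the `λ`-line" and the `abc` conjecture is exactly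
the ONE named binder `habove`: an inequality of Szpiro type at genuine data of points of degree `≥ 2` above an explicit
log-height threshold (plan VERDICT RISK ¶7), claimed here in neither direction. Via `stubHullRegime_of_above` and
abc-iut-c312-8's `ABC_of_cor312_of_hullRegime` (route theorem `closes` with the PROVED `genEllTwo_holds`, `JInvWlog_proof`).
CONDITIONAL on exactly these two `Prop`s; nothing asserted; no side taken on the dispute or on the (U)/(P) reading.
[cite: Mochizuki2012, IUTchIV Thm. 1.10, Cor. 2.2 (ii), Cor. 2.3 pp.22–55] [claim: Mochizuki2012, status: disputed] -/
theorem ABC_of_cor312_of_hullRegimeAbove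
    (h312 : ∀ P : NFPoint, P ∈ UP → ∀ l : ℕ, l.Prime → 5 ≤ l →
      Cor22.AdmitsCore P → Cor22.CondP2 P l → Cor22.CondP5 P l → Cor22.CondP6 P l → Cor22.Cor312AtDatum P l)
    (habove : ∀ P : NFPoint, P ∈ UP → ∀ l : ℕ, l.Prime → 5 ≤ l →
      Cor22.AdmitsCore P → Cor22.CondP2 P l → Cor22.CondP5 P l → Cor22.CondP6 P l →
      2 ≤ Cor22.dmod P →
      40 * Real.log (((2 ^ 12 * 3 ^ 3 * 5 * Cor22.dmod P : ℕ) : ℝ) * l)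
        * ((Nat.primeCounting (2 ^ 12 * 3 ^ 3 * 5 * Cor22.dmod P * l) : ℝ)
          - (2 * (Cor22.dmod P : ℝ) * (P.logDiff + Cor22.logCondAvoid P {2, l}) + Real.log (2 * 3 * 5 * (l : ℝ)))
            / Real.log 2) < Cor22.logQAvoid P {2, l} →
      ∀ T : Cor22.ThetaVolumeDatumAt P l,
        (letI := T.instFieldF; letI := T.instNumberFieldF; letI := T.instAlgebraF; letI := T.instFieldK
         letI := T.instNumberFieldK; letI := T.instAlgebraK; letI := T.instFieldFbar; letI := T.instAlgebraFbar
         letI := T.instAlgebraKFbar; letI := T.instIsElliptic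
         ¬ (∀ p ∈ T.I.supportPrimes, ∀ v w : placesOver (fieldOfModuli T.E) p,
            (Summit.ABC.IUTFork.DHData.ofInput T.I).logQloc p v = (Summit.ABC.IUTFork.DHData.ofInput T.I).logQloc p w)) →
        T.HullEstimateOf
          (((l : ℝ) + 1) / 4 *
            ((1 + 12 * (Cor22.dmod P : ℝ) / l) * (P.logDiff + Cor22.logCondAvoid P {2, l})
              + 2 * Real.log l + 52
              + 20 / 3 * Real.log (((2 ^ 12 * 3 ^ 3 * 5 * Cor22.dmod P : ℕ) : ℝ) * (l : ℝ))
                * (Nat.primeCounting (2 ^ 12 * 3 ^ 3 * 5 * Cor22.dmod P * l) : ℝ)))) : _root_.ABC :=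
  ABC_of_cor312_of_hullRegime h312 (stubHullRegime_of_above habove)

end Summit.ABC.ABC.Theorems.ThetaPartII

end
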